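import Summits.QuantumFields.YangMills.Theorems.BalabanUVNodesN15KingModelFullPropagatorMixedProfile
import Summits.QuantumFields.YangMills.Theorems.BalabanUVNodesN15KingModelFullPropagatorGradHolderSlice

/-!
# BalabanUVNodes ∕ N15 — THE KING-MODEL RUNG, CURVED EDITION (PART Y-a): THE HÖLDER DIFFERENCE OF THE MIXED SLICE — King's (3.65) with
# `|a| = |b| = 1` for the single-scale piece `Σ_w(Σ_z ∂ℋ(x,z)C(z,w))∂ℋ(y,w)` of (2.17), Hölder in the observation point `x`, MASS-UNIFORM
# (input of the sequel `…MixedHolderProfile`: the kernel of [B9]'s (3.45) at `U ≡ 1`)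
# (Track A, DAG node N15 = NE2; FAN-OUT v1.1 §N15 s3 «KING-MODEL RUNG … + the one-line statement of what the curved case adds»)

HONEST FRAMING.  Count-neutral kernel bookkeeping (cell `pub-ymgap`, seat `pub-ymgap-dag-n15-e` g9; `--supports stmt-QuantumFields-20544
--as helper` = K3⁷ `SpineGivenEndpointR13SepCoPH`, WORDS-143).  TEMPLATE LITERATURE, `A = 0`: C. King's scalar U(1)-Higgs MODEL on finite tori ([King1986]
(2.13)–(2.17) p. 653, (3.62) p. 663, Prop. 3.7 (3.63)∕(3.65) p. 663 «`|(∂_α(x, y)D^a_xD^b_zG_{(j)})(z)| ≤ C(L^jη)^{2−d−|a|−|b|−α}exp[−δ₀(L^jη)^{−1}dist({x, y}, z)]`»,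
(4.41)–(4.42) p. 675), NOT Bałaban's covariant objects; [Balaban1985BackgroundPropagators] Thm 3.1 (3.45) p. 398 (the Hölder norm of `∇_UG∇*_Uλ`, whose
kernel at `U ≡ 1` the sequel bounds).  The statement below is the `|a| = |b| = 1` clause of (3.65) for the ASSEMBLED single-scale piece of (2.17) with the
mass inside, decided in the MODEL; NOT a printed proposition; NE2⁺ is NOT PRINTED and not proved here; NOT a node discharge; nothing continuum ∕ ℝ⁴ ∕
OS ∕ mass-gap ∕ Clay.  0 `sorry`, 0 `def`, standard axioms.

THE POINT.  Part U-a did the rows `w·[∂ℋ(x′, z) − ∂ℋ(x, z)]` against the VALUE leg `ℋ(y, ·)`; part W-a the value rows against the GRADIENT leg `∂ℋ(y, ·)`;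
THIS FILE: gradient rows against the gradient leg — the Hölder difference in `x` of part V-a's mixed slice `triple (ksDH μ x) C (ksDH ν y)` (`ksDDSlice_eq`).
Same two-source split (U-a `abs_triple_le_of_two_rows`), same `triple_decay` twice; rows = King's (3.65) for `∂^η_μℋ_j` with the mass inside
(`holder_dkernel_decay_blocks_unif`), leg = part M′ `ksDH_decay_unif`.
* ★ `ksDDSlice_holder_unif` — `0 < α < 1`: `∃ C δ > 0 ∀ 0 < m² ≤ m₀² ∀ i μ ν x x′ y`,
  `(|x − x′|∕N)^{−α}·|triple(∂_μℋ(x′,·))C(∂_νℋ(y,·)) − triple(∂_μℋ(x,·))C(∂_νℋ(y,·))| ≤ C·(e^{−δ|B(x)−B(y)|} + e^{−δ|B(x′)−B(y)|})`.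
WHAT THE CURVED CASE ADDS (one line): the same rows for Bałaban's `G_k(U)` uniformly over `Reg335` ([B9] (3.45), printed, no η-rate).
HONEST SCOPE.  (i) `A = 0`, periodic b.c., odd `L ≥ 3`, `0 < m² ≤ m₀²`, cubes `2L^e`, `0 < α < 1`; (ii) lattice units; sup torus distance; (iii) the
assembled (2.17)-piece, not King's per-`j` kernel `G_{(j)}` of (3.63) verbatim; (iv) not Bałaban's `G_k(U)`; not a discharge.
Locators: [King1986] (2.13)–(2.17) p. 653, (3.62), Prop. 3.7 (3.63)∕(3.65) p. 663, (4.34) p. 674, (4.41)–(4.42) p. 675; [Balaban1985BackgroundPropagators]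
Thm 3.1 (3.45) p. 398.
-/

noncomputable section

namespace Summit.QuantumFields.YangMills.BalabanUVNodes.N15KingModelRung.Curved

open Real Finset Matrix
open Literature.MathematicalPhysics.QuantumFieldTheory.Balaban1983to89 (Params)
open Literature.MathematicalPhysics.QuantumFieldTheory.Balaban1983to89.B4Sect5Proof (latticeConst)
open Literature.MathematicalPhysics.QuantumFieldTheory.Balaban1983to89.B5Prop11Plancherel (Tor fine unitVec)
open Literature.MathematicalPhysics.QuantumFieldTheory.King1986 (aK aK_pos aK_le)
open Literature.MathematicalPhysics.QuantumFieldTheory.King1986.Torus (constrainedProp flatten blockOf tdistT minimiser holdist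
  tdistT_nonneg tdistT_symm tdistT_triangle tdistT_sumBound gam0L kapCT kapCT_pos_le holder_dkernel_decay_blocks_unif)
open Summit.QuantumFields.YangMills.BalabanUVNodes.N15.KingModel (kingRho kingRhoB)

variable {d : ℕ} (L : ℕ) [NeZero L]

/-- **THE HÖLDER DIFFERENCE IN THE OBSERVATION POINT OF THE MIXED SLICE, ONE `(C, δ)` FOR ALL MASSES `0 < m² ≤ m₀²`**: for `0 < α < 1`,
`∃ C δ > 0` such that for every mass under the cap, every slice index (`N = L^j`), all directions `μ, ν` and ALL `x, x′, y`:
`(|x − x′|∕N)^{−α}·|Σ_w(Σ_z[∂_μℋ(x′, z) − ∂_μℋ(x, z)]C(z, w))∂_νℋ(y, w)| ≤ C·(e^{−δ|B(x) − B(y)|_U} + e^{−δ|B(x′) − B(y)|_U})` — rows = King's (3.65) for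
`∂^η_μℋ_j` with the mass inside (`holder_dkernel_decay_blocks_unif`; decay in `min` ≤ the sum of two single-source rows, U-a `abs_triple_le_of_two_rows`),
middle leg n15-d's `kingCov_abs_le`, last leg part M′ `ksDH_decay_unif`; part M v1.1 `triple_decay` twice at the common rate.
[cite: King1986, (3.62) p.663, Prop. 3.7 (3.63)/(3.65) p.663, (4.34) p.674, (4.41)–(4.42) p.675] -/
theorem ksDDSlice_holder_unif (hLodd : Odd L) (hL : 2 ≤ L) {a : ℝ} (ha : 0 < a) {m0sq : ℝ} (hm0 : 0 ≤ m0sq)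
    {α : ℝ} (hα0 : 0 < α) (hα1 : α < 1) :
    ∃ C δ : ℝ, 0 < C ∧ 0 < δ ∧ ∀ (m2 : ℝ), 0 < m2 → m2 ≤ m0sq → ∀ (i : KSliceIdx d) (μ ν : Fin (d + 1))
      (x x' y : Tor (fine (L ^ i.j) (ksU L i))),
      (tdistT (fine (L ^ i.j) (ksU L i)) x x' / ((L ^ i.j : ℕ) : ℝ)) ^ (-α)
          * |triple (ksDH L a m2 i μ x') (ksC L a m2 i) (ksDH L a m2 i ν y)
              - triple (ksDH L a m2 i μ x) (ksC L a m2 i) (ksDH L a m2 i ν y)|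
        ≤ C * (Real.exp (-(δ * tdistT (ksU L i) (blockOf (L ^ i.j) (ksU L i) x) (blockOf (L ^ i.j) (ksU L i) y)))
              + Real.exp (-(δ * tdistT (ksU L i) (blockOf (L ^ i.j) (ksU L i) x') (blockOf (L ^ i.j) (ksU L i) y)))) := by
  have hL1 : 1 < L := by omega
  obtain ⟨δ₀, cH, hδ₀, hcH, Hdec⟩ := ksDH_decay_unif (d := d) L hLodd hL ha hm0
  obtain ⟨δ₃, c₃, hδ₃, hc₃, Hhol⟩ := holder_dkernel_decay_blocks_unif (d + 1) L (Nat.succ_pos d) hLodd hL ha hm0 hα0 hα1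
  have hcC := ksC_const_pos (d := d) L hL ha
  obtain ⟨hκ', _⟩ := kapCT_pos_le (d := d + 1) ha hL
  obtain ⟨κ, hκ, hκ₀, hκ₃, hκC⟩ : ∃ κ : ℝ, 0 < κ ∧ κ ≤ δ₀ ∧ κ ≤ δ₃ ∧ κ ≤ kapCT (d + 1) a L :=
    ⟨min (min δ₀ δ₃) (kapCT (d + 1) a L), lt_min (lt_min hδ₀ hδ₃) hκ', (min_le_left _ _).trans (min_le_left _ _),
      (min_le_left _ _).trans (min_le_right _ _), min_le_right _ _⟩
  set cC : ℝ := (gam0L (d + 1) a L - (kingRho (d + 1) a L + kingRhoB (d + 1) a L))⁻¹ with hcC_def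
  refine ⟨c₃ * cC * cH * latticeConst (d + 1) (κ / 2) ^ 2 + 1, κ / 2, by positivity, half_pos hκ, fun m2 hm hcap i μ ν x x' y => ?_⟩
  have ht0 := tdistT_nonneg (ksU L i)
  have exp_rate_mono : ∀ {κ' r t : ℝ}, κ' ≤ r → 0 ≤ t → Real.exp (-(r * t)) ≤ Real.exp (-(κ' * t)) :=
    fun hκr ht => Real.exp_le_exp.mpr (neg_le_neg (mul_le_mul_of_nonneg_right hκr ht))
  have hVs : ∀ u : Tor (ksU L i), ∑ z, Real.exp (-(κ / 2 * tdistT (ksU L i) u z)) ≤ latticeConst (d + 1) (κ / 2) := fun u =>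
    tdistT_sumBound (ksU L i) (κ / 2) (half_pos hκ) u
  have hV2 : c₃ * cC * cH * latticeConst (d + 1) (κ / 2) ^ 2 ≤ c₃ * cC * cH * latticeConst (d + 1) (κ / 2) ^ 2 + 1 := by linarith
  set w : ℝ := (tdistT (fine (L ^ i.j) (ksU L i)) x x' / ((L ^ i.j : ℕ) : ℝ)) ^ (-α) with hwdef
  have hw0 : 0 ≤ w := Real.rpow_nonneg (div_nonneg (tdistT_nonneg _ _ _) (Nat.cast_nonneg _)) _
  -- the weighted difference is a triple contraction with the weighted two-point row in the first leg
  have hid : w * (triple (ksDH L a m2 i μ x') (ksC L a m2 i) (ksDH L a m2 i ν y)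
        - triple (ksDH L a m2 i μ x) (ksC L a m2 i) (ksDH L a m2 i ν y))
      = triple (fun z => w * (ksDH L a m2 i μ x' z - ksDH L a m2 i μ x z)) (ksC L a m2 i) (ksDH L a m2 i ν y) := by
    rw [triple_smul_left, triple_sub_left]
  -- the two-point row: King's (3.65) for `∂^η_μℋ_j`, mass inside, read as the sum of two single-source rows
  have hrow : ∀ z, |w * (ksDH L a m2 i μ x' z - ksDH L a m2 i μ x z)|
      ≤ c₃ * Real.exp (-(κ * tdistT (ksU L i) (blockOf (L ^ i.j) (ksU L i) x) z))
        + c₃ * Real.exp (-(κ * tdistT (ksU L i) (blockOf (L ^ i.j) (ksU L i) x') z)) := by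
    intro z
    have h := Hhol (i.params L hLodd hL) rfl rfl i.one_le_j m2 hm hcap (ksU L i) (ksU_eq_sitesPerDir L hLodd hL i)
      (L ^ i.j) rfl x x' z μ
    have e : w * (ksDH L a m2 i μ x' z - ksDH L a m2 i μ x z)
        = -((holdist (L ^ i.j) (ksU L i) x x') ^ (-α)
            * ((((L ^ i.j : ℕ) : ℝ)) * (minimiser (L ^ i.j) (ksU L i) (aK a L i.j) ((((L ^ i.j : ℕ) : ℝ)) ^ 2) m2 (Pi.single z 1)
                  (x + unitVec (fine (L ^ i.j) (ksU L i)) μ)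
                - minimiser (L ^ i.j) (ksU L i) (aK a L i.j) ((((L ^ i.j : ℕ) : ℝ)) ^ 2) m2 (Pi.single z 1) x)
              - (((L ^ i.j : ℕ) : ℝ)) * (minimiser (L ^ i.j) (ksU L i) (aK a L i.j) ((((L ^ i.j : ℕ) : ℝ)) ^ 2) m2 (Pi.single z 1)
                  (x' + unitVec (fine (L ^ i.j) (ksU L i)) μ)
                - minimiser (L ^ i.j) (ksU L i) (aK a L i.j) ((((L ^ i.j : ℕ) : ℝ)) ^ 2) m2 (Pi.single z 1) x'))) := by
      simp only [hwdef, ksDH, dkingH, kingH, holdist]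
      ring
    rw [e, abs_neg]
    refine h.trans ?_
    rcases min_choice (tdistT (ksU L i) (blockOf (L ^ i.j) (ksU L i) x) z)
        (tdistT (ksU L i) (blockOf (L ^ i.j) (ksU L i) x') z) with hmin | hmin
    · rw [hmin]
      have h1 : Real.exp (-(δ₃ * tdistT (ksU L i) (blockOf (L ^ i.j) (ksU L i) x) z))
          ≤ Real.exp (-(κ * tdistT (ksU L i) (blockOf (L ^ i.j) (ksU L i) x) z)) := exp_rate_mono hκ₃ (ht0 _ _)
      nlinarith [Real.exp_pos (-(κ * tdistT (ksU L i) (blockOf (L ^ i.j) (ksU L i) x') z)), hc₃.le]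
    · rw [hmin]
      have h1 : Real.exp (-(δ₃ * tdistT (ksU L i) (blockOf (L ^ i.j) (ksU L i) x') z))
          ≤ Real.exp (-(κ * tdistT (ksU L i) (blockOf (L ^ i.j) (ksU L i) x') z)) := exp_rate_mono hκ₃ (ht0 _ _)
      nlinarith [Real.exp_pos (-(κ * tdistT (ksU L i) (blockOf (L ^ i.j) (ksU L i) x) z)), hc₃.le]
  -- the middle and last legs at the common rate
  have hB : ∀ v, |(fun v => |ksDH L a m2 i ν y v|) v|
      ≤ cH * Real.exp (-(κ * tdistT (ksU L i) v (blockOf (L ^ i.j) (ksU L i) y))) := fun v => by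
    show |(|ksDH L a m2 i ν y v|)| ≤ _
    rw [abs_abs, tdistT_symm]
    exact ((Hdec m2 hm.le hcap i ν).1 y v).trans (mul_le_mul_of_nonneg_left (exp_rate_mono hκ₀ (ht0 _ _)) hcH.le)
  have hCm : ∀ z v, |(fun z v => |ksC L a m2 i z v|) z v| ≤ cC * Real.exp (-(κ * tdistT (ksU L i) z v)) := fun z v => by
    show |(|ksC L a m2 i z v|)| ≤ _
    rw [abs_abs]
    exact ((ksC_decay L hL ha hm i z v).1).trans (mul_le_mul_of_nonneg_left (exp_rate_mono hκC (ht0 _ _)) hcC.le)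
  -- the two single-source rows through `triple_decay`
  have hrow₁ : ∀ z, |(fun z => c₃ * Real.exp (-(κ * tdistT (ksU L i) (blockOf (L ^ i.j) (ksU L i) x) z))) z|
      ≤ c₃ * Real.exp (-(κ * tdistT (ksU L i) (blockOf (L ^ i.j) (ksU L i) x) z)) :=
    fun z => by rw [abs_of_nonneg (by positivity)]
  have hrow₂ : ∀ z, |(fun z => c₃ * Real.exp (-(κ * tdistT (ksU L i) (blockOf (L ^ i.j) (ksU L i) x') z))) z|
      ≤ c₃ * Real.exp (-(κ * tdistT (ksU L i) (blockOf (L ^ i.j) (ksU L i) x') z)) :=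
    fun z => by rw [abs_of_nonneg (by positivity)]
  have key₁ := triple_decay (tdistT (ksU L i)) ht0 (tdistT_triangle (ksU L i))
    (f := fun z => c₃ * Real.exp (-(κ * tdistT (ksU L i) (blockOf (L ^ i.j) (ksU L i) x) z)))
    (C := fun z v => |ksC L a m2 i z v|) (g := fun v => |ksDH L a m2 i ν y v|)
    (u₀ := blockOf (L ^ i.j) (ksU L i) x) (v₀ := blockOf (L ^ i.j) (ksU L i) y)
    hκ.le hc₃.le hcC.le hcH.le hrow₁ hCm hB hVs
  have key₂ := triple_decay (tdistT (ksU L i)) ht0 (tdistT_triangle (ksU L i))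
    (f := fun z => c₃ * Real.exp (-(κ * tdistT (ksU L i) (blockOf (L ^ i.j) (ksU L i) x') z)))
    (C := fun z v => |ksC L a m2 i z v|) (g := fun v => |ksDH L a m2 i ν y v|)
    (u₀ := blockOf (L ^ i.j) (ksU L i) x') (v₀ := blockOf (L ^ i.j) (ksU L i) y)
    hκ.le hc₃.le hcC.le hcH.le hrow₂ hCm hB hVs
  have hT₁ : 0 ≤ triple (fun z => c₃ * Real.exp (-(κ * tdistT (ksU L i) (blockOf (L ^ i.j) (ksU L i) x) z)))
      (fun z v => |ksC L a m2 i z v|) (fun v => |ksDH L a m2 i ν y v|) := by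
    simp only [triple]
    exact Finset.sum_nonneg fun v _ => mul_nonneg (Finset.sum_nonneg fun z _ => mul_nonneg (by positivity) (abs_nonneg _))
      (abs_nonneg _)
  have hT₂ : 0 ≤ triple (fun z => c₃ * Real.exp (-(κ * tdistT (ksU L i) (blockOf (L ^ i.j) (ksU L i) x') z)))
      (fun z v => |ksC L a m2 i z v|) (fun v => |ksDH L a m2 i ν y v|) := by
    simp only [triple]
    exact Finset.sum_nonneg fun v _ => mul_nonneg (Finset.sum_nonneg fun z _ => mul_nonneg (by positivity) (abs_nonneg _))
      (abs_nonneg _)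
  rw [abs_of_nonneg hT₁] at key₁
  rw [abs_of_nonneg hT₂] at key₂
  have hsplit := abs_triple_le_of_two_rows (C := ksC L a m2 i) (g := ksDH L a m2 i ν y)
    (f₁ := fun z => c₃ * Real.exp (-(κ * tdistT (ksU L i) (blockOf (L ^ i.j) (ksU L i) x) z)))
    (f₂ := fun z => c₃ * Real.exp (-(κ * tdistT (ksU L i) (blockOf (L ^ i.j) (ksU L i) x') z))) hrow
  have hE₁ := (Real.exp_pos (-(κ / 2 * tdistT (ksU L i) (blockOf (L ^ i.j) (ksU L i) x) (blockOf (L ^ i.j) (ksU L i) y)))).le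
  have hE₂ := (Real.exp_pos (-(κ / 2 * tdistT (ksU L i) (blockOf (L ^ i.j) (ksU L i) x') (blockOf (L ^ i.j) (ksU L i) y)))).le
  calc w * |triple (ksDH L a m2 i μ x') (ksC L a m2 i) (ksDH L a m2 i ν y)
        - triple (ksDH L a m2 i μ x) (ksC L a m2 i) (ksDH L a m2 i ν y)|
      = |w * (triple (ksDH L a m2 i μ x') (ksC L a m2 i) (ksDH L a m2 i ν y)
        - triple (ksDH L a m2 i μ x) (ksC L a m2 i) (ksDH L a m2 i ν y))| := by rw [abs_mul, abs_of_nonneg hw0]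
    _ = |triple (fun z => w * (ksDH L a m2 i μ x' z - ksDH L a m2 i μ x z)) (ksC L a m2 i) (ksDH L a m2 i ν y)| := by rw [hid]
    _ ≤ _ := hsplit
    _ ≤ c₃ * cC * cH * latticeConst (d + 1) (κ / 2) ^ 2
            * Real.exp (-(κ / 2 * tdistT (ksU L i) (blockOf (L ^ i.j) (ksU L i) x) (blockOf (L ^ i.j) (ksU L i) y)))
        + c₃ * cC * cH * latticeConst (d + 1) (κ / 2) ^ 2
            * Real.exp (-(κ / 2 * tdistT (ksU L i) (blockOf (L ^ i.j) (ksU L i) x') (blockOf (L ^ i.j) (ksU L i) y))) :=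
        add_le_add key₁ key₂
    _ ≤ (c₃ * cC * cH * latticeConst (d + 1) (κ / 2) ^ 2 + 1)
            * Real.exp (-(κ / 2 * tdistT (ksU L i) (blockOf (L ^ i.j) (ksU L i) x) (blockOf (L ^ i.j) (ksU L i) y)))
        + (c₃ * cC * cH * latticeConst (d + 1) (κ / 2) ^ 2 + 1)
            * Real.exp (-(κ / 2 * tdistT (ksU L i) (blockOf (L ^ i.j) (ksU L i) x') (blockOf (L ^ i.j) (ksU L i) y))) :=
        add_le_add (mul_le_mul_of_nonneg_right hV2 hE₁) (mul_le_mul_of_nonneg_right hV2 hE₂)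
    _ = _ := by ring

end Summit.QuantumFields.YangMills.BalabanUVNodes.N15KingModelRung.Curved
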